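import Literature.NumberTheory.IwasawaTheory.Greenberg2006.CohomologyCofiniteGenerationHolds
import Literature.NumberTheory.GaloisCohomology.RestrictedRamificationFiniteCohomologyOfPoitouTate
import Literature.NumberTheory.GaloisCohomology.RestrictedRamificationCdTwoOfPoitouTate
import HarnessLib

/-!
# Greenberg 2006, Prop. 3.2 and `cd_p(Gal(K_Σ/K)) ≤ 2` FROM the Poitou–Tate theorem (Harari Thm.
# 17.13 (a), (b)) — the root-fact form

Topic `NumberTheory/IwasawaTheory/Greenberg2006`; namespace
`Literature.NumberTheory.IwasawaTheory.Greenberg2006`. THEOREMS ONLY (no definition, no named fact,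
no `sorry`, no instance).

`CohomologyCofiniteGenerationHolds.lean` proves the named fact `prop32_cohomology_isCofinitelyGenerated`
(Greenberg, *On the structure of certain Galois cohomology groups*, Doc. Math. 2006, Prop. 3.2 at its
binders) from the textbook fact `GaloisCohomology.finite_restrictedCohomology` for every number field
(Harari Cor. 17.17 = NSW (8.3.20) (i)); `GaloisCohomology/RestrictedRamificationFiniteCohomologyOfPoitouTate.lean`
derives that corollary from the Poitou–Tate THEOREM itself (Harari Thm. 17.13 (a) `poitouTate_restricted_three_le`,
(b) `poitouTate_shaRestricted_tateDual`, the tree's root facts of `PoitouTateRestrictedRamification.lean`),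
as print does (Harari p. 296).  This file records the compositions a consumer (route skeleton, planner)
cites when it wants Greenberg's §3–§4 inputs to rest on the ROOT facts only:

* **`prop32_cohomology_isCofinitelyGenerated_of_poitouTate`** —
  `(∀ K, poitouTate_shaRestricted_tateDual K) → (∀ K, poitouTate_restricted_three_le K) →
  prop32_cohomology_isCofinitelyGenerated`;
* `prop32_of_poitouTate_at` — per-field form (the two facts for ONE `K`);
* **`subsingleton_H_of_two_lt_of_poitouTate_at`** — Greenberg's other standing input from [NSW] in §4,
  "the `p`-cohomological dimension of `Gal(K_Σ/K)` is … `2` … when `p` is an odd prime" (p. 359 L30–33),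
  for the totally complex `K` of the tree's Prop. 4.1 typing: `H^q(K_Σ/K, 𝒟) = 0` for `q ≥ 3`, `𝒟`
  discrete `p`-primary, from Thm. 17.13 (a) alone (re-export of
  `GaloisCohomology.subsingleton_H_of_two_lt_of_poitouTate` at Greenberg's binders `hK : ∀ w, w.IsComplex`).

## References
* R. Greenberg, *On the structure of certain Galois cohomology groups*, Doc. Math. Extra Vol. Coates
  (2006) 335–391, Prop. 3.2 (p. 358 L37), §3 A p. 358 L8–13, p. 359 L30–33, §4 p. 367. [Greenberg2006]
* D. Harari, *Galois Cohomology and Class Field Theory*, Universitext (2020), Thm. 17.13, Cor. 17.14,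
  Cor. 17.17 (pp. 294–296). [Harari2020]
* J. Neukirch, A. Schmidt, K. Wingberg, *Cohomology of Number Fields*, 2nd ed. (2008), (8.3.18),
  (8.3.20). [NeukirchSchmidtWingberg2008]
-/

noncomputable section

open scoped Classical NumberField
open NumberField IsDedekindDomain Field IsLocalRing
open Literature.NumberTheory.GaloisRepresentations
open Literature.NumberTheory.GaloisCohomology
open Literature.NumberTheory.IwasawaTheory.Greenberg2016

namespace Literature.NumberTheory.IwasawaTheory.Greenberg2006

/-- **Greenberg 2006, Prop. 3.2 from the Poitou–Tate theorem**: the named fact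
`prop32_cohomology_isCofinitelyGenerated` holds GRANTED Harari Thm. 17.13 (b)
(`poitouTate_shaRestricted_tateDual`) and (a) (`poitouTate_restricted_three_le`) for every number
field — print's chain "[NSW] (8.3.20)" ⟸ Poitou–Tate made explicit
(`finite_restrictedCohomology_of_poitouTate`, then `prop32_cohomology_isCofinitelyGenerated_of_finite_restrictedCohomology`).
[cite: Greenberg2006, Prop. 3.2 (p. 358 L37); §3 A p. 358 L8–13] [cite: Harari2020, Thm. 17.13 and Cor. 17.17 (pp. 294–296)] -/
theorem prop32_cohomology_isCofinitelyGenerated_of_poitouTate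
    (hb : ∀ (K : Type) [Field K] [NumberField K], poitouTate_shaRestricted_tateDual K)
    (ha : ∀ (K : Type) [Field K] [NumberField K], poitouTate_restricted_three_le K) :
    prop32_cohomology_isCofinitelyGenerated :=
  prop32_cohomology_isCofinitelyGenerated_of_finite_restrictedCohomology
    fun K _ _ => finite_restrictedCohomology_of_poitouTate (hb K) (ha K)

/-- **Per-field form**: the conclusion of `prop32_cohomology_isCofinitelyGenerated` at given binders
over ONE number field `K` from the two Poitou–Tate facts for that `K`.
[cite: Greenberg2006, Prop. 3.2 (p. 358 L37)] [cite: Harari2020, Thm. 17.13 and Cor. 17.17 (pp. 294–296)] -/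
theorem prop32_of_poitouTate_at {K : Type} [Field K] [NumberField K]
    (hb : poitouTate_shaRestricted_tateDual K) (ha : poitouTate_restricted_three_le K)
    {p : ℕ} [Fact p.Prime] (S : Set (HeightOneSpectrum (𝓞 K))) (hS : S.Finite)
    (hSp : ∀ v : HeightOneSpectrum (𝓞 K), ((p : ℕ) : 𝓞 K) ∈ v.asIdeal → v ∈ S)
    {Λ : Type} [CommRing Λ] [TopologicalSpace Λ] [IsTopologicalRing Λ] {mΛ : ℕ}
    (e : Λ ≃+* MvPowerSeries (Fin mΛ) ℤ_[p])
    {D : Type} [AddCommGroup D] [Module Λ D] [TopologicalSpace D] [DiscreteTopology D]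
    [ContinuousSMul Λ D] (ρ : ContinuousRep (GaloisGroupUnramifiedOutside K S) Λ D)
    (hD : IsCofinitelyGenerated Λ D) :
    (∀ i : ℕ, IsCofinitelyGenerated Λ (ρ.H i)) ∧
      ∀ (v : NumberField.Place K) (i : ℕ), IsCofinitelyGenerated Λ ((localRep S ρ v).H i) :=
  prop32_of_finite_restrictedCohomology_at (finite_restrictedCohomology_of_poitouTate hb ha) S hS hSp
    e ρ hD

/-- **`H^q(K_Σ/K, 𝒟) = 0` for `q ≥ 3`** at Greenberg's binders — `K` with every infinite place complex
(the typing of Prop. 4.1), `Σ ∋ v ∣ p`, `𝒟` discrete `p`-primary with a continuous `Λ`-linear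
`G_{K,Σ}`-action — GRANTED Thm. 17.13 (a) only ("the `p`-cohomological dimension of `Gal(K_Σ/K)`" is
`≤ 2`; for a totally imaginary `K` no parity condition on `p`).
[cite: Greenberg2006, §3 A (p. 359 L30–33); §4 A Prop. 4.1 (p. 367)] [cite: Harari2020, Cor. 17.14 (p. 295)] -/
theorem subsingleton_H_of_two_lt_of_poitouTate_at {K : Type} [Field K] [NumberField K]
    (ha : poitouTate_restricted_three_le K) (hK : ∀ w : InfinitePlace K, w.IsComplex)
    {p : ℕ} [Fact p.Prime] {S : Set (HeightOneSpectrum (𝓞 K))}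
    (hSp : ∀ v : HeightOneSpectrum (𝓞 K), ((p : ℕ) : 𝓞 K) ∈ v.asIdeal → v ∈ S)
    {Λ : Type} [CommRing Λ] [TopologicalSpace Λ] [IsTopologicalRing Λ]
    {D : Type} [AddCommGroup D] [Module Λ D] [TopologicalSpace D] [DiscreteTopology D]
    [ContinuousSMul Λ D] (ρ : ContinuousRep (GaloisGroupUnramifiedOutside K S) Λ D)
    (hp : ∀ d : D, ∃ n : ℕ, (p ^ n : ℤ) • d = 0) {q : ℕ} (hq : 2 < q) : Subsingleton (ρ.H q) :=
  haveI : IsTotallyComplex K := ⟨hK⟩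
  subsingleton_H_of_two_lt_of_poitouTate ha p hSp ρ hp hq

end Literature.NumberTheory.IwasawaTheory.Greenberg2006

end
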